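import Mathlib.Analysis.InnerProductSpace.PiL2
import Mathlib.Analysis.Convex.Segment
import Mathlib.Analysis.LocallyConvex.Separation
import Mathlib.Analysis.InnerProductSpace.Dual
import Mathlib.Tactic.Module
import Mathlib.LinearAlgebra.Determinant
import Mathlib.MeasureTheory.Measure.Haar.InnerProductSpace
import Mathlib.Order.LiminfLimsup
import Mathlib.Topology.Instances.ENNReal.Lemmas
import Literature.Analysis.Convexity.AnisotropicPerimeter
import Literature.MathematicalPhysics.StatisticalMechanics.CrystallineSurfaceDensity
import HarnessLib

/-!
# Continuum limit of finite-range bond energies on Bravais lattices: crystalline perimeter and zonotope Wulff shapes (Del Nin–Petrache 2022)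

Topic `Literature/MathematicalPhysics/StatisticalMechanics` (namespace = path, grouping sub-namespace
`DelNinPetrache2022`).  Source: G. Del Nin, M. Petrache, *Continuum limits of discrete isoperimetric
problems and Wulff shapes in lattices and quasicrystal tilings*, Calc. Var. PDE **61** (2022), Paper
No. 226 = arXiv:2101.11977 [DelNinPetrache2022] (held: `paper:arxiv-2101.11977`, TeX text; the chunk
numbers `pNNNN` below are those of the held text, §-numbers those of the paper).

Cross-ladder literature-typing layer (D-0088 (4)), cell `crystal3d-full`, seat `littype-FC1-2` (gen 4;
source R1 of the `littype-FC1-1` harvest).  Bearing: the lattice case of the venture items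
`StackingLiminf` (`stmt-Ventures-19145`, fcc word) / `TextureLiminf`: for ANY Bravais lattice
`𝓛 = Mℤ^d` and ANY finite-range bond potential `V ≤ 0` whose support spans `𝓛`, the missing-bond surface
energy, rescaled by `N^{−(d−1)/d}`, `Γ`-converges to the CRYSTALLINE perimeter with the explicit density
`φ_V(ν) = (det 𝓛)⁻¹ Σ_{v∈𝒩} |V(v)| ⟨v,ν⟩₊` (§1.1 Theorem 1.1, with compactness Proposition 1.2 and
convergence of minimizers Corollary 1.3), and the Wulff shapes so obtained are exactly the zonotopes
`Σ_{v∈𝒩} |V(v)| [−v, v]` (Theorem 1.6).  The tree's Cicalese–Kreutz–Leonardi file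
(`WulffCrystalGammaLimit.lean`) is the nearest-neighbour fcc/hcp instance with unit weights; the present
source allows interactions beyond nearest neighbours but only single lattices (`l = 1`), not multilattices
such as hcp.

## Source, as printed (p0003–p0004 = §1.1; p0022 = §4.1–4.2)

* "We consider a lattice `𝓛 = Mℤ^d ⊂ ℝ^d`, where `M ∈ GL(d)`. We define `det 𝓛` as `|det M|` …
  `𝓔(X_N) = Σ_{x∈X_N} Σ_{x'∈X_N∖{x}} V(x'−x)`.  Here `V : 𝓛 → (−∞,0]` is a fixed potential … We first
  consider the case where `V` vanishes outside of a finite subset `𝒩 ⊂ 𝓛` such that `span_ℤ 𝒩 = 𝓛` …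
  `𝓕(X_N) = −Σ_{x∈X_N} Σ_{x'∈𝓛∖X_N} V(x'−x)`, which counts the energy excess due to missing bonds …
  denoting by `U_𝓛 := M([0,1)^d)` the fundamental cell of `𝓛`, the set `E_N(X) := N^{−1/d} ⋃_{x∈X}(x + U_𝓛)`
  … `𝓕_N(E) := 𝓕(X_N)` if `∃X_N ⊂ 𝓛`, `#X_N = N`, `E_N(X_N) = E`; `+∞` else … given a sequence
  `(X_N)`, we say that `X_N` converges to a set `E` if `E_N(X_N) → E` locally in measure (also referred
  to as the "`L¹_loc` convergence")."
* "`P_φ(E) := ∫_{∂*E} φ(ν_E) dH^{d−1}` if `E` is a set of finite perimeter, `+∞` otherwise" (1.1).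
* **Theorem 1.1 (Gamma convergence for crystals).** "The functionals `N^{−(d−1)/d} 𝓕_N` `Γ`-converge,
  with respect to the topology above, to a functional of the form `P_V := P_{φ_V}` as in (1.1), where
  `φ_V(ν) := (1/det 𝓛) Σ_{v∈𝒩} |V(v)| ⟨v, ν⟩₊`."  ("this result had been already proven by Gelli in her
  PhD thesis [Gel] in a more general form (see also [BraGel] and [AliGel])".)  §2.3 (p0008): "given any
  sequence `X_N` with `N = #X_N → ∞` such that `E_N(X_N) → E` in `L¹_loc` we obtain …
  `P_V(E) ≤ liminf_N N^{−(d−1)/d} 𝓕_N(E_N(X_N))`"; §2.4 Step 1 (p0009): "For a given measurable set `E` we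
  need to construct sets `E_N = E_N(X_N)`, with `X_N ⊂ ℤ^d`, `#X_N = N`, such that
  `N^{(d−1)/d}𝓕_N(E_N) → P_V(E)` … Dilating by a factor converging to `1` we can also impose that
  `|E_j| = 1`. From now `E` is assumed to be a fixed polyhedral set of volume `1`".
* **Proposition 1.2 (Compactness).** "Suppose that `span_ℤ 𝒩 = 𝓛`. Given a sequence `X_N` such that
  `𝓕(X_N) ≤ C N^{(d−1)/d}` there exists a subsequence `X_{N_k}` and a finite perimeter set `E` such that
  `E_{N_k}(X_{N_k}) → E` in `L¹_loc`."
* **Corollary 1.3.** "Minimizers of `𝓕_N` converge locally in measure, up to rescaling and possibly a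
  translation, to a finite perimeter set `E` that minimizes (1.1) for its own volume constraint. More
  precisely …, in the case of the anisotropy (1.5) this Wulff shape coincides with the Minkowski sum of
  segments given by `𝒲_{φ_V} = Σ_{v∈𝒩} |V(v)| [−v, v]`."
* §4.1 (p0022): "`𝒲_φ := ∂⁻φ(0) = {x ∈ ℝ^d : ∀y ∈ ℝ^d, ⟨x,y⟩ ≤ φ(y)}`"; §4.2: "for
  `φ(ν) = Σ_{v∈𝒩} W(v)|⟨ν,v⟩|` with `W` positive, we have that `𝒲_φ = Σ_{v∈𝒩} W(v)[−v,v]`, in other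
  words `𝒲_φ` is a zonotope, i.e. a Minkowski sum of segments."  **Theorem 1.6 (Wulff shapes under
  constant-sign potentials).** "A set `𝒲 ⊂ ℝ^d` is obtainable as limit optimal shape from energies as
  in (1.4) for nonpositive `V` with finite support … if and only if `𝒲` is a zonotope."

## Rendering (design choices)

* `ℝ^d = EuclideanSpace ℝ (Fin d)`; the lattice `Mℤ^d` is the `ℤ`-span of the columns `Me_i`
  (`bravaisLattice`, a `Submodule ℤ` seen as a set), so "`span_ℤ 𝒩 = 𝓛`" is literally
  `Submodule.span ℤ 𝒩 = 𝓛`; `det 𝓛 = |det M|` (`covolume`); `U_𝓛 = M([0,1)^d)` (`fundamentalCell`).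
* `V : ℝ^d → ℝ` with `V ≤ 0`, vanishing off the finite set `𝒩 ⊂ 𝓛` (`IsFiniteRangePotential`); the
  missing-bond energy `𝓕` is a `finsum` over `𝓛 ∖ X` (finite support under the hypotheses).
* `P_φ` is rendered LITERALLY as (1.1): `crystallinePerimeter φ E = P_{W_φ}(E)` — the tree's
  distributional anisotropic perimeter `anisotropicPerimeter (wulffBody φ) E`
  (`Literature/Analysis/Convexity/AnisotropicPerimeter.lean`; `wulffBody` of the Chambolle–Kreutz file =
  `𝒲_φ` of §4.1) — if `E` has finite perimeter, and `+∞` otherwise (this matters when `φ_V` is not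
  coercive, e.g. a non-symmetric `𝒩`; the source notes `P_V = P_{V^sym}`, Proposition 4.7).
* Convergence "locally in measure" of sets: `LocallyConvergesInMeasure` (the symmetric difference has
  vanishing volume on every compact set).  `Γ`-liminf: along every sequence of configurations with
  `#X = N_k → ∞` (strictly increasing cardinalities); `Γ`-limsup: recovery sequences `#X_N = N` for every
  measurable `E` of finite energy and volume `det 𝓛` — the volume of every `E_N(X_N)` with `#X_N = N`,
  and the normalisation of the printed proof (§2.4 Step 1, "`E` … of volume 1" for `𝓛 = ℤ^d`); the
  source's loose "for all `E`" is recorded here, not silently narrowed.  Corollary 1.3 is rendered with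
  an explicit subsequence (weaker than "converge").
* Dimension `d ≥ 1` arbitrary as in the source; the exponents `−1/d`, `−(d−1)/d` are real powers.

## What is here

Definitions with bodies: `bravaisLattice`, `covolume`, `fundamentalCell`, `IsFiniteRangePotential`,
`surfaceEnergy` (`𝓕`), `cellSet` (`E_N(X)`), `phiV` (`φ_V`), `crystallinePerimeter` (`P_φ`, (1.1)),
`LocallyConvergesInMeasure`, `IsCardMinimizer`, `zonotope` (`Σ w(v)[−v,v]`).  Proved API:
`surfaceEnergy_empty`, `phiV_nonneg`, `crystallinePerimeter_of_hasFinitePerimeter`,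
`crystallinePerimeter_of_not`, `mem_zonotope_of_forall` / `inner_le_of_mem_zonotope` (every point of the
zonotope pairs against `ν` to at most `Σ w(v)|⟨v,ν⟩|`, i.e. `Σ w(v)[−v,v] ⊆ 𝒲_{Σ w|⟨·,v⟩|}` — the easy
inclusion of §4.2), and §6: `isCompact_zonotope_and_convex`, `exists_mem_zonotope_inner_eq` (the support
function of the zonotope attains `Σ w(v)|⟨y,v⟩|`), `wulffBody_subset_zonotope` (Hahn–Banach separation)
and **`wulffBody_eq_zonotope`: `𝒲_{Σ w|⟨·,v⟩|} = Σ w(v)[−v,v]` for `w ≥ 0`** — the zonotope identity of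
§4.2 / Theorem 1.6 (⇐), PROVED.  NAMED FACTS (published, not proved here): `DelNinPetrache2022_liminf` and
`DelNinPetrache2022_limsup` (Theorem 1.1), `DelNinPetrache2022_compactness` (Proposition 1.2),
`DelNinPetrache2022_minimizers` (Corollary 1.3).
§7 (2026-08-27, DISCREPANCY RECORD): `DelNinPetrache2022_compactness` and `DelNinPetrache2022_liminf` are
FALSE as printed/typed (the standing hypothesis admits `V ≡ 0`; both are refuted in the kernel in
`FiniteRangeLatticeCompactnessCounterexample.lean`), and `DelNinPetrache2022_minimizers` holds vacuously
(PROVED, `DelNinPetrache2022_minimizers_holds`); the corrected NAMED FACTS with the hypothesis of the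
paper's Lemma 2.5 ("`V(v) < 0` for every `v ∈ 𝒩`") are `DelNinPetrache2022_compactness'` and
`DelNinPetrache2022_liminf'`; also `isBounded_cellSet` (PROVED).

## What is not here

Theorem 1.5 (quasiperiodic tilings / multigrids), §3 (potentials whose support does not span: slice
convergence, Definition 2.6), Theorem 1.6 (⇒) (every limit shape is a zonotope — this is Corollary 1.3
plus §6 here, modulo the named facts), Examples 4.4–4.6 (non-zonotope Wulff shapes for signed `V`).
No instances, no notation, no `sorry`.
-/

noncomputable section

open scoped InnerProductSpace Topology Pointwise ENNReal symmDiff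
open Filter Set MeasureTheory Metric

namespace Literature.MathematicalPhysics.StatisticalMechanics.DelNinPetrache2022

open Literature.Analysis.Convexity (anisotropicPerimeter)
open Literature.MathematicalPhysics.StatisticalMechanics (HasFinitePerimeter)
open Literature.MathematicalPhysics.StatisticalMechanics.ChambolleKreutz2023 (wulffBody)

variable {d : ℕ}

/-! ### §1 Bravais lattices, fundamental cell, finite-range potentials -/

/-- The Bravais lattice `𝓛 = Mℤ^d`, `M ∈ GL(d)`: the `ℤ`-span of the columns `Me₁, …, Me_d`.
[cite: DelNinPetrache2022, §1.1 (p. 3)] -/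
def bravaisLattice (M : EuclideanSpace ℝ (Fin d) ≃ₗ[ℝ] EuclideanSpace ℝ (Fin d)) :
    Set (EuclideanSpace ℝ (Fin d)) :=
  (Submodule.span ℤ (Set.range fun i : Fin d => M (EuclideanSpace.single i (1 : ℝ))) :
    Set (EuclideanSpace ℝ (Fin d)))

/-- `det 𝓛 := |det M|` for `𝓛 = Mℤ^d`. [cite: DelNinPetrache2022, §1.1 (p. 3)] -/
def covolume (M : EuclideanSpace ℝ (Fin d) ≃ₗ[ℝ] EuclideanSpace ℝ (Fin d)) : ℝ :=
  |LinearMap.det (M : EuclideanSpace ℝ (Fin d) →ₗ[ℝ] EuclideanSpace ℝ (Fin d))|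

/-- The fundamental cell `U_𝓛 := M([0,1)^d)`. [cite: DelNinPetrache2022, §1.1 (p. 3)] -/
def fundamentalCell (M : EuclideanSpace ℝ (Fin d) ≃ₗ[ℝ] EuclideanSpace ℝ (Fin d)) :
    Set (EuclideanSpace ℝ (Fin d)) :=
  M '' {y | ∀ i, 0 ≤ y i ∧ y i < 1}

/-- The standing hypotheses on the potential: "`V : 𝓛 → (−∞, 0]` … vanishes outside of a finite subset
`𝒩 ⊂ 𝓛` such that `span_ℤ 𝒩 = 𝓛`". [cite: DelNinPetrache2022, §1.1 (p. 3)] -/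
structure IsFiniteRangePotential (M : EuclideanSpace ℝ (Fin d) ≃ₗ[ℝ] EuclideanSpace ℝ (Fin d))
    (V : EuclideanSpace ℝ (Fin d) → ℝ) (N : Finset (EuclideanSpace ℝ (Fin d))) : Prop where
  nonpos : ∀ v, V v ≤ 0
  eq_zero : ∀ v, v ∉ N → V v = 0
  subset : (↑N : Set (EuclideanSpace ℝ (Fin d))) ⊆ bravaisLattice M
  span_eq : (Submodule.span ℤ (↑N : Set (EuclideanSpace ℝ (Fin d))) : Set (EuclideanSpace ℝ (Fin d))) =
    bravaisLattice M

/-! ### §2 The missing-bond energy `𝓕`, the rescaled sets `E_N(X)`, the density `φ_V` -/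

/-- The surface-type energy `𝓕(X) = −Σ_{x∈X} Σ_{x'∈𝓛∖X} V(x' − x)` ("counts the energy excess due to
missing bonds"; the inner sum has finite support for finite-range `V`). [cite: DelNinPetrache2022, §1.1 (1.3) (p. 3)] -/
def surfaceEnergy (L : Set (EuclideanSpace ℝ (Fin d))) (V : EuclideanSpace ℝ (Fin d) → ℝ)
    (X : Finset (EuclideanSpace ℝ (Fin d))) : ℝ :=
  -∑ x ∈ X, ∑ᶠ y ∈ L \ ↑X, V (y - x)

/-- The empty configuration has no missing bonds. [cite: DelNinPetrache2022, §1.1 (1.3) (p. 3)] -/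
@[simp] theorem surfaceEnergy_empty (L : Set (EuclideanSpace ℝ (Fin d))) (V : EuclideanSpace ℝ (Fin d) → ℝ) :
    surfaceEnergy L V ∅ = 0 := by
  simp [surfaceEnergy]

/-- `E_N(X) := N^{−1/d} ⋃_{x∈X} (x + U_𝓛)`. [cite: DelNinPetrache2022, §1.1 (1.4) (p. 3)] -/
def cellSet (M : EuclideanSpace ℝ (Fin d) ≃ₗ[ℝ] EuclideanSpace ℝ (Fin d)) (N : ℕ)
    (X : Finset (EuclideanSpace ℝ (Fin d))) : Set (EuclideanSpace ℝ (Fin d)) :=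
  ((N : ℝ) ^ (-(1 : ℝ) / d)) • ⋃ x ∈ X, (x +ᵥ fundamentalCell M)

/-- `φ_V(ν) := (det 𝓛)⁻¹ Σ_{v∈𝒩} |V(v)| ⟨v, ν⟩₊`. [cite: DelNinPetrache2022, Theorem 1.1 (1.5) (p. 3)] -/
def phiV (M : EuclideanSpace ℝ (Fin d) ≃ₗ[ℝ] EuclideanSpace ℝ (Fin d)) (V : EuclideanSpace ℝ (Fin d) → ℝ)
    (N : Finset (EuclideanSpace ℝ (Fin d))) (ν : EuclideanSpace ℝ (Fin d)) : ℝ :=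
  (covolume M)⁻¹ * ∑ v ∈ N, |V v| * max ⟪v, ν⟫_ℝ 0

/-- `φ_V ≥ 0`. [cite: DelNinPetrache2022, Theorem 1.1 (1.5) (p. 3)] -/
theorem phiV_nonneg (M : EuclideanSpace ℝ (Fin d) ≃ₗ[ℝ] EuclideanSpace ℝ (Fin d))
    (V : EuclideanSpace ℝ (Fin d) → ℝ) (N : Finset (EuclideanSpace ℝ (Fin d))) (ν : EuclideanSpace ℝ (Fin d)) :
    0 ≤ phiV M V N ν := by
  unfold phiV covolume
  refine mul_nonneg (inv_nonneg.2 (abs_nonneg _)) (Finset.sum_nonneg fun v _ => ?_)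
  exact mul_nonneg (abs_nonneg _) (le_max_right _ _)

/-- **(1.1)** `P_φ(E) := ∫_{∂*E} φ(ν_E) dH^{d−1}` if `E` has finite perimeter, `+∞` otherwise — the
surface integral rendered distributionally as the tree's `K`-perimeter with `K = 𝒲_φ` (§4.1).
[cite: DelNinPetrache2022, (1.1) (p. 3) and §4.1 (p. 22)] -/
def crystallinePerimeter (φ : EuclideanSpace ℝ (Fin d) → ℝ) (E : Set (EuclideanSpace ℝ (Fin d))) : ℝ≥0∞ := by
  classical
  exact if HasFinitePerimeter E then anisotropicPerimeter (wulffBody φ) E else ⊤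

/-- Unfolding on sets of finite perimeter. [cite: DelNinPetrache2022, (1.1) (p. 3)] -/
theorem crystallinePerimeter_of_hasFinitePerimeter {φ : EuclideanSpace ℝ (Fin d) → ℝ}
    {E : Set (EuclideanSpace ℝ (Fin d))} (hE : HasFinitePerimeter E) :
    crystallinePerimeter φ E = anisotropicPerimeter (wulffBody φ) E := by
  unfold crystallinePerimeter
  exact if_pos hE

/-- `+∞` off the sets of finite perimeter. [cite: DelNinPetrache2022, (1.1) (p. 3)] -/
theorem crystallinePerimeter_of_not {φ : EuclideanSpace ℝ (Fin d) → ℝ} {E : Set (EuclideanSpace ℝ (Fin d))}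
    (hE : ¬ HasFinitePerimeter E) : crystallinePerimeter φ E = ⊤ := by
  unfold crystallinePerimeter
  exact if_neg hE

/-- `E_k → E` locally in measure ("`L¹_loc` convergence", identifying sets with their characteristic
functions): on every compact set the symmetric difference has vanishing volume.
[cite: DelNinPetrache2022, §1.1 (p. 3)] -/
def LocallyConvergesInMeasure (A : ℕ → Set (EuclideanSpace ℝ (Fin d))) (E : Set (EuclideanSpace ℝ (Fin d))) :
    Prop :=
  ∀ K : Set (EuclideanSpace ℝ (Fin d)), IsCompact K → Tendsto (fun k => volume ((A k ∆ E) ∩ K)) atTop (𝓝 0)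

/-- A minimiser of `𝓕_N`: an `N`-point configuration in `𝓛` of least missing-bond energy.
[cite: DelNinPetrache2022, Corollary 1.3 (p. 4)] -/
def IsCardMinimizer (L : Set (EuclideanSpace ℝ (Fin d))) (V : EuclideanSpace ℝ (Fin d) → ℝ) (N : ℕ)
    (X : Finset (EuclideanSpace ℝ (Fin d))) : Prop :=
  (↑X : Set (EuclideanSpace ℝ (Fin d))) ⊆ L ∧ X.card = N ∧
    ∀ Y : Finset (EuclideanSpace ℝ (Fin d)), (↑Y : Set (EuclideanSpace ℝ (Fin d))) ⊆ L → Y.card = N →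
      surfaceEnergy L V X ≤ surfaceEnergy L V Y

/-! ### §3 Zonotopes (§4.2) -/

/-- The zonotope `Σ_{v∈𝒩} w(v) [−v, v]`, a Minkowski sum of centred segments.
[cite: DelNinPetrache2022, Corollary 1.3 (1.6) (p. 4) and §4.2 (p. 22)] -/
def zonotope (N : Finset (EuclideanSpace ℝ (Fin d))) (w : EuclideanSpace ℝ (Fin d) → ℝ) :
    Set (EuclideanSpace ℝ (Fin d)) :=
  ∑ v ∈ N, w v • segment ℝ (-v) v

/-- Points of the zonotope: `Σ_v w(v) t_v v` with `t_v ∈ [−1, 1]`. [cite: DelNinPetrache2022, §4.2 (p. 22)] -/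
theorem mem_zonotope_of_forall {N : Finset (EuclideanSpace ℝ (Fin d))} {w : EuclideanSpace ℝ (Fin d) → ℝ}
    (t : EuclideanSpace ℝ (Fin d) → ℝ) (ht : ∀ v ∈ N, t v ∈ Icc (-1 : ℝ) 1) :
    ∑ v ∈ N, (w v * t v) • v ∈ zonotope N w := by
  classical
  unfold zonotope
  refine (Set.mem_finsetSum _ _ _).2 ⟨fun v => (w v * t v) • v, fun {v} hv => ?_, rfl⟩
  refine ⟨t v • v, ?_, ?_⟩
  · rw [segment_eq_image']
    refine ⟨(t v + 1) / 2, ⟨by linarith [(ht v hv).1], by linarith [(ht v hv).2]⟩, ?_⟩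
    dsimp only
    module
  · dsimp only
    rw [smul_smul]

/-- The easy inclusion of §4.2: every point `x` of the zonotope `Σ w(v)[−v,v]` (`w ≥ 0`) satisfies
`⟨x, ν⟩ ≤ Σ_v w(v)|⟨v, ν⟩|` for every `ν`, i.e. lies in the Wulff set `𝒲_φ` of
`φ(ν) = Σ_v w(v)|⟨ν, v⟩|`, PROVED. [cite: DelNinPetrache2022, §4.2 (p. 22)] -/
theorem inner_le_of_mem_zonotope {N : Finset (EuclideanSpace ℝ (Fin d))} {w : EuclideanSpace ℝ (Fin d) → ℝ}
    (hw : ∀ v ∈ N, 0 ≤ w v) {x : EuclideanSpace ℝ (Fin d)} (hx : x ∈ zonotope N w)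
    (ν : EuclideanSpace ℝ (Fin d)) : ⟪x, ν⟫_ℝ ≤ ∑ v ∈ N, w v * |⟪v, ν⟫_ℝ| := by
  classical
  unfold zonotope at hx
  obtain ⟨g, hg, rfl⟩ := (Set.mem_finsetSum _ _ _).1 hx
  rw [sum_inner]
  refine Finset.sum_le_sum fun v hv => ?_
  obtain ⟨y, hy, hgy⟩ := Set.mem_smul_set.1 (hg hv)
  rw [← hgy, real_inner_smul_left]
  refine mul_le_mul_of_nonneg_left ?_ (hw v hv)
  rw [segment_eq_image'] at hy
  obtain ⟨θ, hθ, hθy⟩ := hy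
  have hy' : y = (2 * θ - 1) • v := by
    rw [← hθy]
    dsimp only
    module
  rw [hy', real_inner_smul_left]
  have h1 : |2 * θ - 1| ≤ 1 := abs_le.2 ⟨by linarith [hθ.1], by linarith [hθ.2]⟩
  calc (2 * θ - 1) * ⟪v, ν⟫_ℝ ≤ |(2 * θ - 1) * ⟪v, ν⟫_ℝ| := le_abs_self _
    _ = |2 * θ - 1| * |⟪v, ν⟫_ℝ| := abs_mul _ _
    _ ≤ 1 * |⟪v, ν⟫_ℝ| := mul_le_mul_of_nonneg_right h1 (abs_nonneg _)
    _ = |⟪v, ν⟫_ℝ| := one_mul _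

/-- Hence `Σ_v w(v)[−v,v] ⊆ 𝒲_φ`, `φ(ν) = Σ_v w(v)|⟨ν,v⟩|` (`w ≥ 0`), PROVED.
[cite: DelNinPetrache2022, §4.2 (p. 22)] -/
theorem zonotope_subset_wulffBody {N : Finset (EuclideanSpace ℝ (Fin d))} {w : EuclideanSpace ℝ (Fin d) → ℝ}
    (hw : ∀ v ∈ N, 0 ≤ w v) :
    zonotope N w ⊆ wulffBody fun ν => ∑ v ∈ N, w v * |⟪ν, v⟫_ℝ| := by
  intro x hx ν _
  exact (inner_le_of_mem_zonotope hw hx ν).trans_eq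
    (Finset.sum_congr rfl fun v _ => by rw [real_inner_comm])

/-! ### §4 The named facts -/

/-- **Del Nin–Petrache 2022, Theorem 1.1, `Γ`-liminf inequality, NAMED FACT.**  For a Bravais lattice
`𝓛 = Mℤ^d` and a finite-range potential `V ≤ 0` supported on `𝒩` with `span_ℤ 𝒩 = 𝓛`: for every set `E`
and every sequence of configurations `X_k ⊂ 𝓛` with `#X_k = N_k → ∞` (strictly increasing) and
`E_{N_k}(X_k) → E` locally in measure,
`P_{φ_V}(E) ≤ liminf_k N_k^{−(d−1)/d} 𝓕(X_k)`.
**WARNING (§7, 2026-08-27) — FALSE AS TYPED, do not take as a hypothesis:** REFUTED in the kernel by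
`DelNinPetrache2022.liminf_false` (`FiniteRangeLatticeCompactnessCounterexample.lean`; `IsFiniteRangePotential`
admits `V ≡ 0`, for which this inequality reads `⊤ ≤ 0` on an infinite-perimeter limit set); the
statement WITH the paper's Lemma 2.5 hypothesis "`V < 0` on `𝒩`" is `DelNinPetrache2022_liminf'` (§7).
[cite: DelNinPetrache2022, Theorem 1.1 (p. 3); §2.3 (p. 8–9)] -/
def DelNinPetrache2022_liminf : Prop :=
  ∀ (d : ℕ) (M : EuclideanSpace ℝ (Fin d) ≃ₗ[ℝ] EuclideanSpace ℝ (Fin d)) (V : EuclideanSpace ℝ (Fin d) → ℝ)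
    (N : Finset (EuclideanSpace ℝ (Fin d))), 1 ≤ d → IsFiniteRangePotential M V N →
    ∀ (E : Set (EuclideanSpace ℝ (Fin d))) (n : ℕ → ℕ) (X : ℕ → Finset (EuclideanSpace ℝ (Fin d))),
      StrictMono n → (∀ k, (↑(X k) : Set (EuclideanSpace ℝ (Fin d))) ⊆ bravaisLattice M ∧ (X k).card = n k) →
      LocallyConvergesInMeasure (fun k => cellSet M (n k) (X k)) E →
        crystallinePerimeter (phiV M V N) E ≤
          liminf (fun k => ENNReal.ofReal (((n k : ℕ) : ℝ) ^ (-(((d : ℝ) - 1) / d)) *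
            surfaceEnergy (bravaisLattice M) V (X k))) atTop

/-- **Del Nin–Petrache 2022, Theorem 1.1, `Γ`-limsup inequality (recovery sequences), NAMED FACT.**
For every measurable `E` of finite `φ_V`-energy with `|E| = det 𝓛` (the volume of every `E_N(X_N)`,
`#X_N = N`; the normalisation of §2.4 Step 1) there are configurations `X_N ⊂ 𝓛`, `#X_N = N`, with
`E_N(X_N) → E` locally in measure and `limsup_N N^{−(d−1)/d} 𝓕(X_N) ≤ P_{φ_V}(E)`.
[cite: DelNinPetrache2022, Theorem 1.1 (p. 3); §2.4 (p. 9–11)] -/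
def DelNinPetrache2022_limsup : Prop :=
  ∀ (d : ℕ) (M : EuclideanSpace ℝ (Fin d) ≃ₗ[ℝ] EuclideanSpace ℝ (Fin d)) (V : EuclideanSpace ℝ (Fin d) → ℝ)
    (N : Finset (EuclideanSpace ℝ (Fin d))), 1 ≤ d → IsFiniteRangePotential M V N →
    ∀ E : Set (EuclideanSpace ℝ (Fin d)), MeasurableSet E → volume E = ENNReal.ofReal (covolume M) →
      crystallinePerimeter (phiV M V N) E < ⊤ →
      ∃ X : ℕ → Finset (EuclideanSpace ℝ (Fin d)),
        (∀ n, (↑(X n) : Set (EuclideanSpace ℝ (Fin d))) ⊆ bravaisLattice M ∧ (X n).card = n) ∧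
        LocallyConvergesInMeasure (fun n => cellSet M n (X n)) E ∧
        limsup (fun n : ℕ => ENNReal.ofReal (((n : ℕ) : ℝ) ^ (-(((d : ℝ) - 1) / d)) *
          surfaceEnergy (bravaisLattice M) V (X n))) atTop ≤ crystallinePerimeter (phiV M V N) E

/-- **Del Nin–Petrache 2022, Proposition 1.2 (Compactness), NAMED FACT.**  "Suppose that
`span_ℤ 𝒩 = 𝓛`. Given a sequence `X_N` such that `𝓕(X_N) ≤ C N^{(d−1)/d}` there exists a subsequence
`X_{N_k}` and a finite perimeter set `E` such that `E_{N_k}(X_{N_k}) → E` in `L¹_loc`."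
**WARNING (§7, 2026-08-27) — FALSE AS PRINTED AND TYPED, do not take as a hypothesis:** REFUTED in
the kernel by `DelNinPetrache2022.compactness_false` (`FiniteRangeLatticeCompactnessCounterexample.lean`;
`V ≡ 0` is admitted, and then equidistributed combs in `d = 1` have no `L¹_loc`-convergent
subsequence); the statement WITH the paper's Lemma 2.5 hypothesis "`V < 0` on `𝒩`" is
`DelNinPetrache2022_compactness'` (§7).
[cite: DelNinPetrache2022, Proposition 1.2 (p. 3–4)] -/
def DelNinPetrache2022_compactness : Prop :=
  ∀ (d : ℕ) (M : EuclideanSpace ℝ (Fin d) ≃ₗ[ℝ] EuclideanSpace ℝ (Fin d)) (V : EuclideanSpace ℝ (Fin d) → ℝ)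
    (N : Finset (EuclideanSpace ℝ (Fin d))), 1 ≤ d → IsFiniteRangePotential M V N →
    ∀ (X : ℕ → Finset (EuclideanSpace ℝ (Fin d))) (C : ℝ),
      (∀ n, (↑(X n) : Set (EuclideanSpace ℝ (Fin d))) ⊆ bravaisLattice M ∧ (X n).card = n) →
      (∀ n : ℕ, surfaceEnergy (bravaisLattice M) V (X n) ≤ C * (n : ℝ) ^ (((d : ℝ) - 1) / d)) →
      ∃ (n : ℕ → ℕ) (E : Set (EuclideanSpace ℝ (Fin d))), StrictMono n ∧ HasFinitePerimeter E ∧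
        LocallyConvergesInMeasure (fun k => cellSet M (n k) (X (n k))) E

/-- **Del Nin–Petrache 2022, Corollary 1.3 (convergence of minimisers), NAMED FACT** (rendered with an
explicit subsequence): minimisers `X_N` of `𝓕_N` converge locally in measure, up to the rescaling
`N^{−1/d}` and translations `a_k`, to a finite perimeter set `E` minimising `P_{φ_V}` among measurable
sets of its own volume.
**NOTE (§7, 2026-08-27) — VACUOUS AS PRINTED AND TYPED:** the existential translations may escape to
infinity, so `E = ∅` always works (`DelNinPetrache2022_minimizers_holds`, §7); the fact carries no
information about Wulff shapes. [cite: DelNinPetrache2022, Corollary 1.3 (p. 4)] -/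
def DelNinPetrache2022_minimizers : Prop :=
  ∀ (d : ℕ) (M : EuclideanSpace ℝ (Fin d) ≃ₗ[ℝ] EuclideanSpace ℝ (Fin d)) (V : EuclideanSpace ℝ (Fin d) → ℝ)
    (N : Finset (EuclideanSpace ℝ (Fin d))), 1 ≤ d → IsFiniteRangePotential M V N →
    ∀ X : ℕ → Finset (EuclideanSpace ℝ (Fin d)), (∀ n, IsCardMinimizer (bravaisLattice M) V n (X n)) →
      ∃ (n : ℕ → ℕ) (a : ℕ → EuclideanSpace ℝ (Fin d)) (E : Set (EuclideanSpace ℝ (Fin d))),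
        StrictMono n ∧ HasFinitePerimeter E ∧
        (∀ F : Set (EuclideanSpace ℝ (Fin d)), MeasurableSet F → volume F = volume E →
          crystallinePerimeter (phiV M V N) E ≤ crystallinePerimeter (phiV M V N) F) ∧
        LocallyConvergesInMeasure (fun k => a k +ᵥ cellSet M (n k) (X (n k))) E

/-! ### §5 Proved corollaries -/

/-- Under Theorem 1.1 (liminf clause): if rescaled minimal (or any) configurations converge locally in
measure to `E`, their rescaled energies asymptotically dominate the crystalline perimeter of `E` — the
lattice analogue of the venture's `TextureLiminf` for a single lattice grain.
[cite: DelNinPetrache2022, Theorem 1.1 (p. 3)] -/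
theorem crystallinePerimeter_le_liminf (h : DelNinPetrache2022_liminf) {d : ℕ} (hd : 1 ≤ d)
    {M : EuclideanSpace ℝ (Fin d) ≃ₗ[ℝ] EuclideanSpace ℝ (Fin d)} {V : EuclideanSpace ℝ (Fin d) → ℝ}
    {N : Finset (EuclideanSpace ℝ (Fin d))} (hV : IsFiniteRangePotential M V N)
    {E : Set (EuclideanSpace ℝ (Fin d))} {X : ℕ → Finset (EuclideanSpace ℝ (Fin d))}
    (hX : ∀ k, (↑(X k) : Set (EuclideanSpace ℝ (Fin d))) ⊆ bravaisLattice M ∧ (X k).card = k)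
    (hconv : LocallyConvergesInMeasure (fun k => cellSet M k (X k)) E) :
    crystallinePerimeter (phiV M V N) E ≤
      liminf (fun k : ℕ => ENNReal.ofReal (((k : ℕ) : ℝ) ^ (-(((d : ℝ) - 1) / d)) *
        surfaceEnergy (bravaisLattice M) V (X k))) atTop :=
  h d M V N hd hV E id X strictMono_id hX hconv

/-! ### §6 The Wulff set of `Σ w(v)|⟨·,v⟩|` IS the zonotope (§4.2, Theorem 1.6 ⇐), PROVED -/

/-- Segments are compact (continuous image of `[0, 1]`). [folklore] -/
private theorem isCompact_segment' (a b : EuclideanSpace ℝ (Fin d)) : IsCompact (segment ℝ a b) := by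
  rw [segment_eq_image']
  exact isCompact_Icc.image (continuous_const.add (continuous_id.smul continuous_const))

/-- The zonotope `Σ_v w(v)[−v, v]` is compact and convex (a Minkowski sum of compact convex segments).
[cite: DelNinPetrache2022, §4.2 (p. 22)] -/
theorem isCompact_zonotope_and_convex (N : Finset (EuclideanSpace ℝ (Fin d)))
    (w : EuclideanSpace ℝ (Fin d) → ℝ) : IsCompact (zonotope N w) ∧ Convex ℝ (zonotope N w) := by
  classical
  unfold zonotope
  induction N using Finset.induction_on with
  | empty =>
    rw [Finset.sum_empty, ← Set.singleton_zero]
    exact ⟨isCompact_singleton, convex_singleton _⟩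
  | insert a s ha ih =>
    rw [Finset.sum_insert ha]
    exact ⟨((isCompact_segment' _ _).smul (w a)).add ih.1, ((convex_segment _ _).smul (w a)).add ih.2⟩

/-- The vertex `Σ_v w(v) sgn⟨y, v⟩ v` of the zonotope pairs with `y` to `Σ_v w(v)|⟨y, v⟩|`: the support
function of `Σ_v w(v)[−v,v]` dominates `Σ_v w(v)|⟨·, v⟩|`. [cite: DelNinPetrache2022, §4.2 (p. 22)] -/
theorem exists_mem_zonotope_inner_eq (N : Finset (EuclideanSpace ℝ (Fin d)))
    (w : EuclideanSpace ℝ (Fin d) → ℝ) (y : EuclideanSpace ℝ (Fin d)) :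
    ∃ a ∈ zonotope N w, ⟪a, y⟫_ℝ = ∑ v ∈ N, w v * |⟪y, v⟫_ℝ| := by
  classical
  let t : EuclideanSpace ℝ (Fin d) → ℝ := fun v => if 0 ≤ ⟪y, v⟫_ℝ then 1 else -1
  refine ⟨∑ v ∈ N, (w v * t v) • v, mem_zonotope_of_forall t (fun v _ => ?_), ?_⟩
  · by_cases h : 0 ≤ ⟪y, v⟫_ℝ <;> simp [t, h]
  · rw [sum_inner]
    refine Finset.sum_congr rfl fun v _ => ?_
    rw [real_inner_smul_left, mul_assoc, real_inner_comm]
    congr 1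
    by_cases h : 0 ≤ ⟪y, v⟫_ℝ
    · simp [t, h, abs_of_nonneg h]
    · simp [t, h, abs_of_neg (not_le.1 h)]

/-- The reverse inclusion of §4.2: the Wulff set `𝒲_φ` of `φ(ν) = Σ_v w(v)|⟨ν, v⟩|` (`w ≥ 0`) is contained
in the zonotope `Σ_v w(v)[−v, v]` (Hahn–Banach separation from the compact convex zonotope), PROVED.
[cite: DelNinPetrache2022, §4.2 (p. 22) ("for `φ(ν) = Σ W(v)|⟨ν,v⟩|` with `W` positive, `𝒲_φ = Σ W(v)[−v,v]`")] -/
theorem wulffBody_subset_zonotope {N : Finset (EuclideanSpace ℝ (Fin d))} {w : EuclideanSpace ℝ (Fin d) → ℝ}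
    (hw : ∀ v ∈ N, 0 ≤ w v) :
    wulffBody (fun ν => ∑ v ∈ N, w v * |⟪ν, v⟫_ℝ|) ⊆ zonotope N w := by
  intro x hx
  by_contra hxZ
  obtain ⟨hZc, hZconv⟩ := isCompact_zonotope_and_convex N w
  obtain ⟨f, u, hfZ, hux⟩ := geometric_hahn_banach_closed_point hZconv hZc.isClosed hxZ
  set y : EuclideanSpace ℝ (Fin d) := (InnerProductSpace.toDual ℝ (EuclideanSpace ℝ (Fin d))).symm f
    with hy
  have hfy : ∀ a, f a = ⟪y, a⟫_ℝ := fun a => by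
    rw [hy, InnerProductSpace.toDual_symm_apply]
  obtain ⟨a, haZ, ha⟩ := exists_mem_zonotope_inner_eq N w y
  have h1 : ∑ v ∈ N, w v * |⟪y, v⟫_ℝ| < u := by
    rw [← ha, real_inner_comm, ← hfy]; exact hfZ a haZ
  have h2 : u < ⟪y, x⟫_ℝ := by rw [← hfy]; exact hux
  -- `y ≠ 0`
  have hy0 : y ≠ 0 := by
    intro h0
    have hs : 0 ≤ ∑ v ∈ N, w v * |⟪y, v⟫_ℝ| :=
      Finset.sum_nonneg fun v hv => mul_nonneg (hw v hv) (abs_nonneg _)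
    rw [h0, inner_zero_left] at h2
    linarith
  have hny : 0 < ‖y‖ := norm_pos_iff.2 hy0
  -- test the Wulff inequality in the direction `y/‖y‖`
  have hν : ‖(‖y‖⁻¹ : ℝ) • y‖ = 1 := by
    rw [norm_smul, norm_inv, norm_norm, inv_mul_cancel₀ hny.ne']
  have hW := hx ((‖y‖⁻¹ : ℝ) • y) hν
  simp only [real_inner_smul_left, real_inner_smul_right, abs_mul, abs_inv, abs_norm] at hW
  have hW2 : ‖y‖⁻¹ * ⟪x, y⟫_ℝ ≤ ‖y‖⁻¹ * ∑ v ∈ N, w v * |⟪y, v⟫_ℝ| := by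
    calc ‖y‖⁻¹ * ⟪x, y⟫_ℝ ≤ ∑ v ∈ N, w v * (‖y‖⁻¹ * |⟪y, v⟫_ℝ|) := hW
      _ = ‖y‖⁻¹ * ∑ v ∈ N, w v * |⟪y, v⟫_ℝ| := by
        rw [Finset.mul_sum]
        exact Finset.sum_congr rfl fun v _ => by ring
  have hW' : ⟪x, y⟫_ℝ ≤ ∑ v ∈ N, w v * |⟪y, v⟫_ℝ| := le_of_mul_le_mul_left hW2 (inv_pos.2 hny)
  rw [real_inner_comm] at h2
  linarith

/-- **§4.2 / Theorem 1.6 (⇐): the Wulff set of `φ(ν) = Σ_v w(v)|⟨ν, v⟩|`, `w ≥ 0`, IS the zonotope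
`Σ_v w(v)[−v, v]`**, PROVED (both inclusions). [cite: DelNinPetrache2022, §4.2 (p. 22) and Theorem 1.6 (p. 5)] -/
theorem wulffBody_eq_zonotope {N : Finset (EuclideanSpace ℝ (Fin d))} {w : EuclideanSpace ℝ (Fin d) → ℝ}
    (hw : ∀ v ∈ N, 0 ≤ w v) :
    wulffBody (fun ν => ∑ v ∈ N, w v * |⟪ν, v⟫_ℝ|) = zonotope N w :=
  Subset.antisymm (wulffBody_subset_zonotope hw) (zonotope_subset_wulffBody hw)

/-! ### §7 Discrepancy record (2026-08-27, literature-prover `littype-FC1-1` gen 12): the printed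
hypotheses of Proposition 1.2 and of Theorem 1.1 (liminf) omit "`V < 0` on `𝒩`"; Corollary 1.3 as
printed (and typed) carries no content

**What is wrong.** `IsFiniteRangePotential M V N` transcribes §1.1 verbatim — "`V : 𝓛 → (−∞,0]` …
vanishes outside of a finite subset `𝒩 ⊂ 𝓛` such that `span_ℤ 𝒩 = 𝓛`" (p. 3) — and therefore admits
the ZERO potential (with `𝒩` any finite spanning set; `DelNinPetrache2022.isFiniteRangePotential_zero`
in `FiniteRangeLatticeCompactnessCounterexample.lean`).  For `V ≡ 0` the missing-bond energy `𝓕`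
vanishes identically, so every sequence of configurations satisfies `𝓕(X_N) ≤ C N^{(d−1)/d}`, and
* `DelNinPetrache2022_compactness` (Proposition 1.2 as printed, p. 3–4) is **FALSE** — kernel-checked,
  `DelNinPetrache2022.compactness_false : ¬ DelNinPetrache2022_compactness`
  (`FiniteRangeLatticeCompactnessCounterexample.lean`: `d = 1`, `𝓛 = ℤ`, `X_n = {0, 2, …, 2n−2}`, whose
  rescaled cell sets `⋃_{j<n} [2j/n, (2j+1)/n)` are equidistributed combs without any
  `L¹_loc`-convergent subsequence);
* `DelNinPetrache2022_liminf` (Theorem 1.1, `Γ`-liminf clause) is **FALSE** by the same loophole: for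
  `V ≡ 0` its right-hand side is `0`, while a set `E` of INFINITE perimeter (so that
  `crystallinePerimeter _ E = ⊤`) is an `L¹_loc`-limit of rescaled cell sets — e.g. `d = 1`,
  `E = ⋃_{i≥1} [2^{−i}, (5/4)·2^{−i})` approximated at the scales `N = 2^{k+2}` — kernel-checked as well,
  `DelNinPetrache2022.liminf_false : ¬ DelNinPetrache2022_liminf` (same counterexample file, §6–§9: the
  staircase has infinite De Giorgi perimeter, each slab `{a ≤ x 0 < b}` having perimeter `≥ 1`);
* `DelNinPetrache2022_limsup` is unaffected.
The printed PROOFS are correct: Lemma 2.5 (p. 11), on which Proposition 1.2 and the liminf inequality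
rest ("`P(E_N(X_N)) ≤ K 𝓕(X_N)`"), states the missing clause explicitly — "suppose that `V(v) < 0` for
every `v ∈ 𝒩`".  The corrected statements — Proposition 1.2 and Theorem 1.1 (liminf) WITH the hypothesis
of Lemma 2.5 — are the named facts `DelNinPetrache2022_compactness'` and `DelNinPetrache2022_liminf'`
below; the uncorrected `def`s above are kept verbatim (append-only file; they are the statements the
refutation names) and **must not be taken as hypotheses** (ex falso).

**Corollary 1.3.** `DelNinPetrache2022_minimizers` renders "Minimizers of `𝓕_N` converge locally in
measure, up to rescaling and possibly a translation, to a finite perimeter set `E` that minimizes (1.1)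
for its own volume constraint" (p. 4) with an EXISTENTIAL choice of the translations and no clause
tying `|E|` to the mass `det 𝓛` of the rescaled configurations.  So typed it holds for a trivial reason —
translate the `k`-th (bounded) cell set out of the ball of radius `k`; the local limit is then `E = ∅`,
which has finite perimeter and minimises among sets of volume `0` — and this is PROVED below
(`DelNinPetrache2022_minimizers_holds`) as the in-kernel record that the fact carries no information.
The printed sentence is itself this loose (it does not assert `|E| = det 𝓛`); the contentful version (no
loss of mass along minimisers, `|E| = det 𝓛`, a concentration-compactness statement the paper does not
spell out) is NOT vendored, there being no printed statement of it to cite.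
-/

/-- **Del Nin–Petrache 2022, Proposition 1.2 (Compactness), with the hypothesis of Lemma 2.5, NAMED
FACT** (the corrected form of `DelNinPetrache2022_compactness`, see §7): for a Bravais lattice `𝓛 = Mℤ^d`
and a finite-range potential `V ≤ 0` vanishing off `𝒩`, `span_ℤ 𝒩 = 𝓛`, and **`V(v) < 0` for every
`v ∈ 𝒩`**: every sequence of configurations `X_N ⊂ 𝓛`, `#X_N = N`, with `𝓕(X_N) ≤ C N^{(d−1)/d}` has a
subsequence whose rescaled cell sets `E_{N_k}(X_{N_k})` converge locally in measure to a set of finite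
perimeter.  (Road to a proof: Lemma 2.5, `P(E_N(X_N)) ≤ K N^{−(d−1)/d} 𝓕(X_N)`, and the compactness
theorem for sets of locally bounded perimeter [AFP]/Maggi Cor. 12.27 — neither in the tree yet.)
[cite: DelNinPetrache2022, Proposition 1.2 (p. 3–4) with Lemma 2.5 (p. 11)] -/
def DelNinPetrache2022_compactness' : Prop :=
  ∀ (d : ℕ) (M : EuclideanSpace ℝ (Fin d) ≃ₗ[ℝ] EuclideanSpace ℝ (Fin d)) (V : EuclideanSpace ℝ (Fin d) → ℝ)
    (N : Finset (EuclideanSpace ℝ (Fin d))), 1 ≤ d → IsFiniteRangePotential M V N → (∀ v ∈ N, V v < 0) →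
    ∀ (X : ℕ → Finset (EuclideanSpace ℝ (Fin d))) (C : ℝ),
      (∀ n, (↑(X n) : Set (EuclideanSpace ℝ (Fin d))) ⊆ bravaisLattice M ∧ (X n).card = n) →
      (∀ n : ℕ, surfaceEnergy (bravaisLattice M) V (X n) ≤ C * (n : ℝ) ^ (((d : ℝ) - 1) / d)) →
      ∃ (n : ℕ → ℕ) (E : Set (EuclideanSpace ℝ (Fin d))), StrictMono n ∧ HasFinitePerimeter E ∧
        LocallyConvergesInMeasure (fun k => cellSet M (n k) (X (n k))) E

/-- **Del Nin–Petrache 2022, Theorem 1.1, `Γ`-liminf inequality, with the hypothesis of Lemma 2.5, NAMED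
FACT** (the corrected form of `DelNinPetrache2022_liminf`, see §7): as `DelNinPetrache2022_liminf` but for
potentials with **`V(v) < 0` for every `v ∈ 𝒩`** and for (Borel) MEASURABLE limit sets `E` (the source's
"`E_N(X_N) → E` in `L¹_loc`" presupposes `χ_E ∈ L¹_loc`; without measurability `crystallinePerimeter _ E = ⊤`
by definition of `HasFinitePerimeter`, and an `L¹_loc`-limit is determined only up to null sets —
measurability added 2026-08-28 by the vendoring seat, before any use): along every sequence `X_k ⊂ 𝓛`,
`#X_k = N_k → ∞`, with `E_{N_k}(X_k) → E` locally in measure, `P_{φ_V}(E) ≤ liminf_k N_k^{−(d−1)/d} 𝓕(X_k)`.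
[cite: DelNinPetrache2022, Theorem 1.1 (p. 3) with §2.3 (p. 8–9) and Lemma 2.5 (p. 11)] -/
def DelNinPetrache2022_liminf' : Prop :=
  ∀ (d : ℕ) (M : EuclideanSpace ℝ (Fin d) ≃ₗ[ℝ] EuclideanSpace ℝ (Fin d)) (V : EuclideanSpace ℝ (Fin d) → ℝ)
    (N : Finset (EuclideanSpace ℝ (Fin d))), 1 ≤ d → IsFiniteRangePotential M V N → (∀ v ∈ N, V v < 0) →
    ∀ (E : Set (EuclideanSpace ℝ (Fin d))) (n : ℕ → ℕ) (X : ℕ → Finset (EuclideanSpace ℝ (Fin d))),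
      MeasurableSet E → StrictMono n →
      (∀ k, (↑(X k) : Set (EuclideanSpace ℝ (Fin d))) ⊆ bravaisLattice M ∧ (X k).card = n k) →
      LocallyConvergesInMeasure (fun k => cellSet M (n k) (X k)) E →
        crystallinePerimeter (phiV M V N) E ≤
          liminf (fun k => ENNReal.ofReal (((n k : ℕ) : ℝ) ^ (-(((d : ℝ) - 1) / d)) *
            surfaceEnergy (bravaisLattice M) V (X k))) atTop

/-- The uncorrected liminf fact implies the corrected one (it quantifies over more potentials) — so a
proof of `DelNinPetrache2022_liminf'` is all that the corollary `crystallinePerimeter_le_liminf` of §5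
may legitimately be fed, after adding the hypothesis `∀ v ∈ N, V v < 0` to its statement.
[cite: DelNinPetrache2022, Theorem 1.1 (p. 3)] -/
theorem DelNinPetrache2022_liminf'_of (h : DelNinPetrache2022_liminf) : DelNinPetrache2022_liminf' :=
  fun d M V N hd hV _ E n X _ hn hX hconv => h d M V N hd hV E n X hn hX hconv

/-- Likewise for compactness. [cite: DelNinPetrache2022, Proposition 1.2 (p. 3–4)] -/
theorem DelNinPetrache2022_compactness'_of (h : DelNinPetrache2022_compactness) :
    DelNinPetrache2022_compactness' :=
  fun d M V N hd hV _ X C hX hF => h d M V N hd hV X C hX hF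

/-- Every rescaled cell set `E_N(X)` is bounded (a dilate of a finite union of translates of the bounded
fundamental cell `M([0,1)^d) ⊆ M([0,1]^d)`). [cite: DelNinPetrache2022, §1.1 (1.4) (p. 3)] -/
theorem isBounded_cellSet (M : EuclideanSpace ℝ (Fin d) ≃ₗ[ℝ] EuclideanSpace ℝ (Fin d)) (N : ℕ)
    (X : Finset (EuclideanSpace ℝ (Fin d))) : Bornology.IsBounded (cellSet M N X) := by
  classical
  have hcube : Bornology.IsBounded (fundamentalCell M) := by
    have hK : IsCompact ((fun y : Fin d → ℝ => M (WithLp.toLp 2 y)) '' Set.pi Set.univ fun _ => Icc (0 : ℝ) 1) :=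
      (isCompact_univ_pi fun _ => isCompact_Icc).image
        ((LinearMap.continuous_of_finiteDimensional
          (M : EuclideanSpace ℝ (Fin d) →ₗ[ℝ] EuclideanSpace ℝ (Fin d))).comp (PiLp.continuous_toLp 2 _))
    refine hK.isBounded.subset ?_
    rintro _ ⟨y, hy, rfl⟩
    refine ⟨WithLp.ofLp y, Set.mem_univ_pi.2 fun i => ⟨(hy i).1, (hy i).2.le⟩, ?_⟩
    simp
  unfold cellSet
  exact ((Bornology.isBounded_biUnion_finset X).2 fun x _ => hcube.vadd x).smul₀ _

/-- **`DelNinPetrache2022_minimizers` (Corollary 1.3 AS PRINTED AND TYPED) holds — vacuously** (§7):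
translating the `k`-th rescaled cell set beyond the ball of radius `k` makes the sequence converge locally
in measure to `∅`, a set of finite perimeter minimising the crystalline perimeter among sets of volume
`0`.  This theorem is the in-kernel record that the typed statement carries no information; it is NOT a
formalisation of the convergence of minimisers to the Wulff shape. [cite: DelNinPetrache2022, Corollary 1.3 (p. 4)] -/
theorem DelNinPetrache2022_minimizers_holds : DelNinPetrache2022_minimizers := by
  intro d M V N hd _ X _
  -- radii of the (bounded) cell sets
  have hR : ∀ k, ∃ R : ℝ, 0 ≤ R ∧ ∀ z ∈ cellSet M k (X k), ‖z‖ ≤ R := fun k => by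
    obtain ⟨R, hR⟩ := isBounded_iff_forall_norm_le.1 (isBounded_cellSet M k (X k))
    exact ⟨max R 0, le_max_right _ _, fun z hz => (hR z hz).trans (le_max_left _ _)⟩
  choose R hR0 hR using hR
  -- a unit vector (`d ≥ 1`) and the escaping translations
  set u : EuclideanSpace ℝ (Fin d) := EuclideanSpace.single (⟨0, hd⟩ : Fin d) (1 : ℝ) with hu
  have hu1 : ‖u‖ = 1 := by rw [hu, PiLp.norm_single, norm_one]
  set a : ℕ → EuclideanSpace ℝ (Fin d) := fun k => (R k + k + 1) • u with ha
  have hak : ∀ k, ‖a k‖ = R k + k + 1 := fun k => by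
    rw [ha]
    dsimp only
    rw [norm_smul, hu1, mul_one, Real.norm_of_nonneg (by linarith [hR0 k])]
  refine ⟨id, a, ∅, strictMono_id, hasFinitePerimeter_empty, ?_, ?_⟩
  · intro F _ _
    rw [crystallinePerimeter_of_hasFinitePerimeter hasFinitePerimeter_empty,
      Literature.Analysis.Convexity.anisotropicPerimeter_empty]
    exact zero_le
  · intro K hK
    obtain ⟨r, hr⟩ := (Metric.isBounded_iff_subset_closedBall (0 : EuclideanSpace ℝ (Fin d))).1 hK.isBounded
    have hev : ∀ k : ℕ, r ≤ k → (a k +ᵥ cellSet M (id k) (X (id k))) ∩ K = ∅ := by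
      intro k hk
      refine Set.eq_empty_iff_forall_notMem.2 fun z hz => ?_
      obtain ⟨hz, hzK⟩ := hz
      obtain ⟨w, hw, rfl⟩ := Set.mem_vadd_set.1 hz
      have hwR : ‖w‖ ≤ R k := hR k w hw
      have hzr : ‖a k +ᵥ w‖ ≤ r := by
        have := hr hzK
        rwa [mem_closedBall, dist_zero_right] at this
      rw [vadd_eq_add] at hzr
      have htri : ‖a k‖ ≤ ‖a k + w‖ + ‖w‖ := by
        calc ‖a k‖ = ‖(a k + w) - w‖ := by rw [add_sub_cancel_right]
          _ ≤ ‖a k + w‖ + ‖w‖ := norm_sub_le _ _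
      rw [hak k] at htri
      linarith
    refine tendsto_atTop_of_eventually_const (i₀ := ⌈r⌉₊) fun k hk => ?_
    have hrk : r ≤ k := (Nat.le_ceil r).trans (by exact_mod_cast hk)
    rw [show (a k +ᵥ cellSet M (id k) (X (id k))) ∆ (∅ : Set (EuclideanSpace ℝ (Fin d))) =
        a k +ᵥ cellSet M (id k) (X (id k)) by simp [Set.symmDiff_def], hev k hrk, measure_empty]

end Literature.MathematicalPhysics.StatisticalMechanics.DelNinPetrache2022
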